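import Literature.AlgebraicGeometry.Resolution.QuasiExcellentSchemes
import Literature.AlgebraicGeometry.Resolution.ProperModelsPatching
import Literature.AlgebraicGeometry.Resolution.ExcellentRingsFieldProofs
import Literature.AlgebraicGeometry.Resolution.AlterationsDimension
import HarnessLib

/-!
# ResolutionOfSingularities / UniversalCells — crux `LocalToGlobal`, line `birth` (v3.2):
# strong resolution of sandwiched schemes in dimension `≤ 3` from Cossart–Piltant Thm. 1.1 (ii)

Crux `stmt-ResolutionOfSingularities-15232`, decl `UniversalCells.LocalToGlobal`, stub
`stub_sandwichedStrong_dimLe_three_of_cossartPiltant2019General` of the dimension-split line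
`birth` v3.2.

Let `k` be a field, `U` an integral separated `k`-scheme of finite type of (topological Krull)
dimension `≤ 3`, and `η : V → U` a proper birational morphism from an integral scheme `V`. Under
the printed Cossart–Piltant theorem `CossartPiltant2019General` (Thm. 1.1 (i)–(ii): every reduced
separated Noetherian quasi-excellent scheme of dimension `≤ 3` has a resolution which is an
isomorphism over its regular locus), `V` has a resolution `π : Y → V` which is an isomorphism over
an open `W ⊆ V` whose points are exactly `Reg V` — the dimension-`≤ 3` part of the strong
sandwiched statement `SandwichedStrongResolution` (`ProperModelsPatching.lean`; the regularity
of `U` there is not needed here).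

Proof: the bookkeeping of `CossartPiltant2019General.resolutionOverUpToDim` for the structure
morphism `η ≫ f : V → Spec k`, which is separated, locally of finite type and quasi-compact (`η`
proper): `V` is separated (`Scheme.isSeparated_of_isSeparated_over`), Noetherian
(`Scheme.isNoetherian_of_finiteType_over_field`), reduced (integral) and quasi-excellent
(`Scheme.isQuasiExcellent_of_locallyOfFiniteType` with the tree theorem `Stacks07QW_field_holds`,
finite type algebras over a field are excellent); and `dim V = dim U ≤ 3` by birationality: over
the dense open `O ⊆ U` of `IsBirational η` the restriction `η⁻¹(O) ≅ O` is an isomorphism, so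
`dim V = dim η⁻¹(O)` (a non-empty open of an integral scheme locally of finite type over a field
has the same dimension, `topologicalKrullDim_opens_eq`, Görtz–Wedhorn I Thm. 5.22 (3))
`= dim O ≤ dim U`.

## References

* V. Cossart, O. Piltant, J. Algebra 529 (2019) 268–535, Thm. 1.1. [CossartPiltant2019]
* U. Görtz, T. Wedhorn, *Algebraic Geometry I*, 2nd ed. (2020), Thm. 5.22 (3). [GortzWedhorn2020]
* The Stacks Project, Tag 07QW. [StacksProject]
-/

-- `Summit.<Summit>.<Sub>.Theorems` with `Sub = Summit` (single-conjunct summit, D-0017)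
set_option linter.dupNamespace false

noncomputable section

open CategoryTheory AlgebraicGeometry TopologicalSpace
open Literature.AlgebraicGeometry.Resolution

namespace Summit.ResolutionOfSingularities.ResolutionOfSingularities.Theorems

/-- **Strong resolution of sandwiched schemes in dimension `≤ 3`, from the printed
Cossart–Piltant theorem.** Under `CossartPiltant2019General` (Cossart–Piltant 2019, Thm. 1.1
(i)–(ii)): for a field `k`, an integral separated finite-type `k`-scheme `U` of dimension `≤ 3`
and an integral `V` proper and birational over `U`, there is a resolution `π : Y → V` (proper,
birational, `Y` regular) which is an isomorphism over an open `W ⊆ V` whose points are exactly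
`Reg V`. Indeed `V → Spec k` is separated and of finite type, so `V` is a reduced separated
Noetherian quasi-excellent scheme (finite type algebras over a field are excellent,
`Stacks07QW_field_holds`), and `dim V = dim U ≤ 3` since `η` is an isomorphism over a dense open
and non-empty opens of integral schemes locally of finite type over a field have full dimension.
[cite: CossartPiltant2019, Thm. 1.1 (ii)] -/
theorem stub_sandwichedStrong_dimLe_three_of_cossartPiltant2019General
    (hG : CossartPiltant2019General.{0}) (k : Type) [Field k] (U V : Scheme.{0})
    (f : U ⟶ Spec (.of k)) (η : V ⟶ U) [IsSeparated f] [LocallyOfFiniteType f] [QuasiCompact f]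
    [IsIntegral U] [IsIntegral V] [IsProper η] (hb : IsBirational η)
    (hdim : topologicalKrullDim U ≤ 3) :
    ∃ (Y : Scheme.{0}) (π : Y ⟶ V), IsResolution π ∧
      ∃ W : V.Opens, (W : Set V) = Scheme.regularLocus V ∧ IsIso (π ∣_ W) := by
  -- the structure morphism `η ≫ f : V → Spec k` is separated, locally of finite type and
  -- quasi-compact (`η` proper), so `V` is separated, Noetherian and quasi-excellent
  haveI : V.IsSeparated := Scheme.isSeparated_of_isSeparated_over (η ≫ f)
  haveI : IsNoetherian V := Scheme.isNoetherian_of_finiteType_over_field (η ≫ f)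
  have hqe : Scheme.IsQuasiExcellent V :=
    Scheme.isQuasiExcellent_of_locallyOfFiniteType Stacks07QW_field_holds (η ≫ f)
  -- `dim V = dim η⁻¹(O) = dim O ≤ dim U ≤ 3` over the dense open `O` of birationality
  have hdimV : topologicalKrullDim V ≤ 3 := by
    obtain ⟨O, -, hO'd, hOiso⟩ := hb
    haveI := hOiso
    have hO'ne : ((η ⁻¹ᵁ O : V.Opens) : Set V).Nonempty := hO'd.nonempty
    have h1 := topologicalKrullDim_opens_eq (η ≫ f) (η ⁻¹ᵁ O) hO'ne
    have h2 : topologicalKrullDim ((η ⁻¹ᵁ O : V.Opens) : Scheme.{0}) =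
        topologicalKrullDim ((O : U.Opens) : Scheme.{0}) :=
      IsHomeomorph.topologicalKrullDim_eq _ (Scheme.homeoOfIso (asIso (η ∣_ O))).isHomeomorph
    have h3 : topologicalKrullDim ((O : U.Opens) : Scheme.{0}) ≤ topologicalKrullDim U :=
      O.ι.isOpenEmbedding.isInducing.topologicalKrullDim_le
    rw [← h1, h2]
    exact h3.trans hdim
  exact hG V hqe hdimV

end Summit.ResolutionOfSingularities.ResolutionOfSingularities.Theorems

end
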